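import Summits.HodgeConjecture.HodgeConjecture.Theorems.F0P3cStCharTSWeylHypJacobianUniformDock   -- ★ p851969 (this seat) (J6) FILE 3 «UNIFORM DOCK» `tubeJacobianLocal_of_uniformPackage`
import Summits.HodgeConjecture.HodgeConjecture.Theorems.F0P3cStCharTSLevelPackage                -- ★ p851901 (LH6-p03 g5) (J6-M) `orbit_and_mass_of_small_level`, `exists_small_level_bound`
import Summits.HodgeConjecture.HodgeConjecture.Theorems.F0P3cStCharTSModelWriting                -- ★ p851981 (LH6-p03 g5) (J6-W) `cm_model_writing`, `valuation_apply_eq_of_valued_eq`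
import Summits.HodgeConjecture.HodgeConjecture.Theorems.F0P3cStCharTSModelHaarPins               -- ★ p851908 (LH6-p03 g5) (T5) `exists_isHaarMeasure_unipotentU`
import Summits.HodgeConjecture.HodgeConjecture.Theorems.F0P3cStCharTSWeightLocConst              -- ★ (F0P2-p02 g21) (J6-D) `eventually_isRegularElt_and_valued_rootUnits_eq`, `eventually_vanDijkWeight_eq_of_isRegularElt`; brings `glDiagonal_torusEntry_eq`
import Literature.NumberTheory.Automorphic.TateLocalZetaShells                                      -- ★ `secondCountableTopology_localField`
import HarnessLib

/-!
# F0 · P3c · line LH6 «StCharTS» — ROAD «JAC-LOC» brick (J6) «ASSEMBLY → hJacLoc», FILE 4 «CLOSE MODULO (T4)»: the local tube-Jacobian socket of ★ p851645 for any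
# weight `D` with `D = (Re Δ)²` (van Dijk's `|D_G|²` on the split torus), from the ONE remaining dictionary entry (T4) «model twist product `=` (Re Δ)²» (Harish-Chandra 1970 L. 22)

Cell `pub/hodgecm-mathlib`, crux H413 = `stmt-HodgeConjecture-24833` (lane `--supports`, helper); seat LH6-p04 (g6); (J6) ED. 3 of LH6-p03 (g5)'s ROAD «JAC-LOC» (memo
`F0/P3b/LH6-p03/g5/ROAD-JAC-LOC.v3.LH6p03g5.md` §5–§6; docking notes F0∕P3b 15:57:52Z, (J6-W) 16:07:02Z).  THEOREMS ONLY; sorry-free; no definition ∕ instance ∕ notation; axioms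
TRIO.  HONEST LABEL: count-neutral, closes no organ; CONDITIONAL on the single dictionary hypothesis `hT4` ((T4) «MODULUS TRANSPORT», in flight on the road); HC_CM is proved only
modulo the 7 printed citations (2 remaining: hLiu418 = `stmt-HodgeConjecture-24832`, h413 = `stmt-HodgeConjecture-24833`) until rung 0 closes.

WHAT.  `G = U(Φ₃)(L⁺_v)`, `T = (cmBorelTriple L 3 v).M`, `U′ = U(σ_w′, Φ₃)(L_w′)` the one-place model, `e = localNonsplitEquiv`, `D : T → ℝ≥0` any weight with
`(D t : ℝ) = (Re Δ(t))²` (★ `F0P3cStCharTSTorusDefs.vanDijkWeight`; `= D_G(t)²` by ★ (J7) ∕ ★ DG-FIELD, which is how the consumer's `hDGsq` reads it).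
**`tubeJacobianLocal_of_modulusTransport`**: the `hJacLoc` clause of ★ p851645 (VERBATIM) from `hT4` = «for every regular `s ∈ T` with CM writing `d`, model writing
`dw = (d i)(w′)` of `e s` and Weyl partner `sw` (exactly the data of ★ (J6-W) `cm_model_writing`), the MASS CONSTANT of ★ (J6-M) `orbit_and_mass_of_small_level` at `(e s, sw, dw)`
— `‖a−1‖·χ⁻(b−1)` at `e s` times the same at `sw`, token for token, read in `ℝ` — equals `(Re Δ(s))²`».  PROOF = ★ (J6) FILE 3 `tubeJacobianLocal_of_uniformPackage` with: `θ` any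
value `0 < θ < 1` (Mathlib `ValuativeRel.IsNontrivial.exists_lt_one`); `hDlc` = ★ (J6-D) `eventually_vanDijkWeight_eq_of_isRegularElt`; `hunif` at `t₀`: the neighbourhood of ★ (J6-D)
`eventually_isRegularElt_and_valued_rootUnits_eq` (regularity + the four root-unit sizes `|a−1|, |b−1|, |a_w−1|, |b_w−1|` constant, read at `w′` through ★ (J6-W) `h5` +
`valuation_apply_eq_of_valued_eq`), `γ₀` from ★ `exists_small_level_bound A B A′ B′ A A′ (v ⅟2) θ` at the sizes of `t₀` (`C := A`, `C′ := A′` by ★ (J6-W) `h6`), then for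
`s ∈ U`, `0 ≠ γ ≤ γ₀`: ★ (J6-W) at `s`, ★ (J6-M) `orbit_and_mass_of_small_level` ⇒ `P̃`; ORBIT-TUBE verbatim, MASS with the constant rewritten by `hT4` and `hD`.
FILE 5 (when ★ (T4) lands): discharge `hT4` — then «radial measure `= D_G²·tm` on `T^{reg}`» is UNCONDITIONAL by ★ p851645.

## References
* [HarishChandra1970] Harish-Chandra, *Harmonic analysis on reductive p-adic groups*, LNM 162 (1970), Lemma 22, Lemma 42.
* [Rogawski1990] J. D. Rogawski, *Automorphic Representations of Unitary Groups in Three Variables*, Ann. of Math. Stud. 123 (1990), §12.5 p. 182; L. 12.7.2 (proof) p. 193.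
* [vanDijk1972] G. van Dijk, *Computation of certain induced characters of p-adic groups*, Math. Ann. 199 (1972), §2.
-/

set_option autoImplicit false
set_option linter.dupNamespace false

noncomputable section

open MeasureTheory Measure Set Filter Topology Function NumberField IsDedekindDomain Matrix Polynomial ValuativeRel
open Literature.MeasureTheory.Group
open Literature.NumberTheory Literature.NumberTheory.Automorphic Literature.NumberTheory.Automorphic.UnitaryGroup Literature.NumberTheory.Rogawski1990
open Literature.NumberTheory.Automorphic.UnitaryGroup.HeisRing
open Summit.HodgeConjecture.HodgeConjecture.Cruxes.H413
open Summit.HodgeConjecture.HodgeConjecture.Cruxes.H413.F0P3cStCharTSWeylHypJacobianUniformDock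
open Summit.HodgeConjecture.HodgeConjecture.Cruxes.H413.F0P3cStCharTSTubeModelTransport
open Summit.HodgeConjecture.HodgeConjecture.Cruxes.H413.F0P3cStCharTSModelWriting
open Summit.HodgeConjecture.HodgeConjecture.Cruxes.H413.F0P3cStCharTSLevelPackage
open Summit.HodgeConjecture.HodgeConjecture.Cruxes.H413.F0P3cStCharTSModelHaarPins
open Summit.HodgeConjecture.HodgeConjecture.Cruxes.H413.F0P3cStCharTSWeightLocConst
open Summit.HodgeConjecture.HodgeConjecture.Cruxes.H413.F0P3cStCharTSTorusUnipotentConj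
open Summit.HodgeConjecture.HodgeConjecture.Cruxes.H413.F0P3cStCharTSShellOrbitalG
open scoped ENNReal NNReal MatrixGroups Pointwise

namespace Summit.HodgeConjecture.HodgeConjecture.Cruxes.H413.F0P3cStCharTSWeylHypJacobianClose

section CM

variable (L : Type) [Field L] [NumberField L] [IsCMField L] (v : HeightOneSpectrum (𝓞 ↥(maximalRealSubfield L)))

set_option maxHeartbeats 6400000 in
set_option synthInstance.maxHeartbeats 400000 in
-- the (J6-M) instantiation: long model terms (class of ★ (J6-M) ∕ ★ (J6-W))
/-- **(J6) «CLOSE MODULO (T4)»**: the local tube-Jacobian socket `hJacLoc` of ★ p851645 for a weight `D` with `D = (Re Δ)²` on the split torus of `U(Φ₃)(L⁺_v)` (`v` non-split),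
from the single dictionary hypothesis `hT4` (the (J6-M) mass constant at the model writing of `e s`, read in `ℝ`, IS `(Re Δ(s))²`) — module docstring.
[cite: HarishChandra1970, Lemma 22; Lemma 42] [cite: Rogawski1990, §12.5 p. 182] [cite: vanDijk1972, §2] -/
theorem tubeJacobianLocal_of_modulusTransport
    (hns : ∀ w : PlacesOver L v, IsCMField.complexConj L • w.1 = w.1)
    [MeasurableSpace ↥(unitaryGroupOfForm (conjLocal L (IsCMField.complexConj L) v) (cmLocalForm L 3 v))] [BorelSpace ↥(unitaryGroupOfForm (conjLocal L (IsCMField.complexConj L) v) (cmLocalForm L 3 v))] [LocallyCompactSpace ↥(unitaryGroupOfForm (conjLocal L (IsCMField.complexConj L) v) (cmLocalForm L 3 v))] [SecondCountableTopology ↥(unitaryGroupOfForm (conjLocal L (IsCMField.complexConj L) v) (cmLocalForm L 3 v))] [T2Space ↥(unitaryGroupOfForm (conjLocal L (IsCMField.complexConj L) v) (cmLocalForm L 3 v))]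
    [MeasurableSpace (↥(unitaryGroupOfForm (conjLocal L (IsCMField.complexConj L) v) (cmLocalForm L 3 v)) ⧸ (cmBorelTriple L 3 v).M)] [BorelSpace (↥(unitaryGroupOfForm (conjLocal L (IsCMField.complexConj L) v) (cmLocalForm L 3 v)) ⧸ (cmBorelTriple L 3 v).M)]
    (ν : Measure ↥(unitaryGroupOfForm (conjLocal L (IsCMField.complexConj L) v) (cmLocalForm L 3 v))) [ν.IsHaarMeasure] [ν.IsMulRightInvariant]
    (tm : Measure ↥(cmBorelTriple L 3 v).M) [tm.IsMulLeftInvariant] [IsFiniteMeasureOnCompacts tm] [tm.IsOpenPosMeasure] [tm.IsInvInvariant]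
    (Φ : (↥(unitaryGroupOfForm (conjLocal L (IsCMField.complexConj L) v) (cmLocalForm L 3 v)) ⧸ (cmBorelTriple L 3 v).M) × ↥(cmBorelTriple L 3 v).M → ↥(unitaryGroupOfForm (conjLocal L (IsCMField.complexConj L) v) (cmLocalForm L 3 v))) (hΦ : ∀ (x : ↥(unitaryGroupOfForm (conjLocal L (IsCMField.complexConj L) v) (cmLocalForm L 3 v))) (t : ↥(cmBorelTriple L 3 v).M), Φ (QuotientGroup.mk x, t) = x * t * x⁻¹)
    (w : ↥(unitaryGroupOfForm (conjLocal L (IsCMField.complexConj L) v) (cmLocalForm L 3 v))) (hw : Units.val (w : GL (Fin 3) (LocalRing L v)) = cmLocalForm L 3 v)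
    (D : ↥(cmBorelTriple L 3 v).M → ℝ≥0) (hD : ∀ t : ↥(cmBorelTriple L 3 v).M, (D t : ℝ) = ((F0P3cStCharTSTorusDefs.vanDijkWeight L v t).re) ^ 2)
    (w' : PlacesOver L v) (hw' : IsCMField.complexConj L • w'.1 = w'.1)
    [MeasurableSpace ↥(unitaryGroupOfForm (galAdicCompletionMap (L := L) (IsCMField.complexConj L) hw') (placeForm (Rogawski1990.qsForm L) w'.1))] [BorelSpace ↥(unitaryGroupOfForm (galAdicCompletionMap (L := L) (IsCMField.complexConj L) hw') (placeForm (Rogawski1990.qsForm L) w'.1))]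
    [MeasurableSpace (w'.1.adicCompletion L)] [BorelSpace (w'.1.adicCompletion L)] [Invertible (2 : (w'.1.adicCompletion L))]
    (hT4 : ∀ (s : ↥(cmBorelTriple L 3 v).M) (_hregs : IsRegularElt (((s : ↥(unitaryGroupOfForm (conjLocal L (IsCMField.complexConj L) v) (cmLocalForm L 3 v)))) : GL (Fin 3) (LocalRing L v)))
      (d : Fin 3 → (LocalRing L v)ˣ) (_hd : glDiagonal 3 (LocalRing L v) d = (((s : ↥(unitaryGroupOfForm (conjLocal L (IsCMField.complexConj L) v) (cmLocalForm L 3 v)))) : GL (Fin 3) (LocalRing L v)))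
      (t sw : ↥(torusU (galAdicCompletionMap (L := L) (IsCMField.complexConj L) hw') (placeForm (Rogawski1990.qsForm L) w'.1))) (_ht : (t : ↥(unitaryGroupOfForm (galAdicCompletionMap (L := L) (IsCMField.complexConj L) hw') (placeForm (Rogawski1990.qsForm L) w'.1))) = (localNonsplitEquiv (IsCMField.complexConj L) (Rogawski1990.qsForm L) (IsCMField.complexConj_ne_one L) w' hw') (s : ↥(unitaryGroupOfForm (conjLocal L (IsCMField.complexConj L) v) (cmLocalForm L 3 v))))
      (dw : Fin 3 → ((w'.1.adicCompletion L))ˣ)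
      (_h5 : ∀ i j : Fin 3, ((((dw i)⁻¹ * dw j : ((w'.1.adicCompletion L))ˣ) : (w'.1.adicCompletion L)) - 1) = ((((d i)⁻¹ * d j : (LocalRing L v)ˣ) : LocalRing L v) - 1) w')
      (hdt : glDiagonal 3 (w'.1.adicCompletion L) dw = ((t : ↥(unitaryGroupOfForm (galAdicCompletionMap (L := L) (IsCMField.complexConj L) hw') (placeForm (Rogawski1990.qsForm L) w'.1))) : GL (Fin 3) (w'.1.adicCompletion L)))
      (hdsw : glDiagonal 3 (w'.1.adicCompletion L) (dw ∘ Fin.rev) = ((sw : ↥(unitaryGroupOfForm (galAdicCompletionMap (L := L) (IsCMField.complexConj L) hw') (placeForm (Rogawski1990.qsForm L) w'.1))) : GL (Fin 3) (w'.1.adicCompletion L)))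
      (hregt : IsRegularElt ((t : ↥(unitaryGroupOfForm (galAdicCompletionMap (L := L) (IsCMField.complexConj L) hw') (placeForm (Rogawski1990.qsForm L) w'.1))) : GL (Fin 3) (w'.1.adicCompletion L)))
      (hregsw : IsRegularElt ((sw : ↥(unitaryGroupOfForm (galAdicCompletionMap (L := L) (IsCMField.complexConj L) hw') (placeForm (Rogawski1990.qsForm L) w'.1))) : GL (Fin 3) (w'.1.adicCompletion L))),
      ((distribHaarChar (w'.1.adicCompletion L) (isUnit_rootA_sub_one (galAdicCompletionMap (L := L) (IsCMField.complexConj L) hw') t hdt hregt).unit *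
              skewModulus (galAdicCompletionMap (L := L) (IsCMField.complexConj L) hw') (model_pins L v w' hw').2.2.1 (isUnit_rootB_sub_one (galAdicCompletionMap (L := L) (IsCMField.complexConj L) hw') t hdt hregt).unit
                (map_unit_torusCentralScalar_sub_one (galAdicCompletionMap (L := L) (IsCMField.complexConj L) hw') (model_pins L v w' hw').2.2.2 t hdt (isUnit_rootB_sub_one (galAdicCompletionMap (L := L) (IsCMField.complexConj L) hw') t hdt hregt)) : ℝ≥0) : ℝ) *
          ((distribHaarChar (w'.1.adicCompletion L) (isUnit_rootA_sub_one (galAdicCompletionMap (L := L) (IsCMField.complexConj L) hw') sw hdsw hregsw).unit *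
              skewModulus (galAdicCompletionMap (L := L) (IsCMField.complexConj L) hw') (model_pins L v w' hw').2.2.1 (isUnit_rootB_sub_one (galAdicCompletionMap (L := L) (IsCMField.complexConj L) hw') sw hdsw hregsw).unit
                (map_unit_torusCentralScalar_sub_one (galAdicCompletionMap (L := L) (IsCMField.complexConj L) hw') (model_pins L v w' hw').2.2.2 sw hdsw (isUnit_rootB_sub_one (galAdicCompletionMap (L := L) (IsCMField.complexConj L) hw') sw hdsw hregsw)) : ℝ≥0) : ℝ) =
        ((F0P3cStCharTSTorusDefs.vanDijkWeight L v s).re) ^ 2) :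
    ∀ t₀ : ↥(cmBorelTriple L 3 v).M, IsRegularElt (((t₀ : ↥(unitaryGroupOfForm (conjLocal L (IsCMField.complexConj L) v) (cmLocalForm L 3 v)))) : GL (Fin 3) (LocalRing L v)) →
      ∃ U : Set ↥(cmBorelTriple L 3 v).M, IsOpen U ∧ t₀ ∈ U ∧
        ∃ A₀ : Set (↥(unitaryGroupOfForm (conjLocal L (IsCMField.complexConj L) v) (cmLocalForm L 3 v)) ⧸ (cmBorelTriple L 3 v).M), MeasurableSet A₀ ∧ (quotientMeasure (cmBorelTriple L 3 v).M tm (isClosed_cmBorelTriple_M L v) ν) A₀ ≠ 0 ∧ (quotientMeasure (cmBorelTriple L 3 v).M tm (isClosed_cmBorelTriple_M L v) ν) A₀ ≠ ∞ ∧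
          ∀ V : Set ↥(cmBorelTriple L 3 v).M, MeasurableSet V → V ⊆ U → (∀ t ∈ V, IsRegularElt (((t : ↥(unitaryGroupOfForm (conjLocal L (IsCMField.complexConj L) v) (cmLocalForm L 3 v)))) : GL (Fin 3) (LocalRing L v))) →
            (∀ t ∈ V, ∀ t' ∈ V, ((t' : ↥(cmBorelTriple L 3 v).M) : ↥(unitaryGroupOfForm (conjLocal L (IsCMField.complexConj L) v) (cmLocalForm L 3 v))) ≠ w * t * w⁻¹) →
              ν (Φ '' (A₀ ×ˢ V)) = (quotientMeasure (cmBorelTriple L 3 v).M tm (isClosed_cmBorelTriple_M L v) ν) A₀ * ∫⁻ t in V, (D t : ℝ≥0∞) ∂tm := by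
  classical
  obtain ⟨hσσ, hσv, hσc', hJ'⟩ := model_pins L v w' hw'
  -- a level ratio `0 < θ < 1`
  obtain ⟨θ, hθpos, hθ1⟩ := ValuativeRel.IsNontrivial.exists_lt_one (R := (w'.1.adicCompletion L))
  have hθ0 : θ ≠ 0 := hθpos.ne'
  -- model instances and a Haar measure on `N′`
  haveI : SecondCountableTopology (w'.1.adicCompletion L) := secondCountableTopology_localField _
  letI : MeasurableSpace ↥(unipotentU (galAdicCompletionMap (L := L) (IsCMField.complexConj L) hw') (placeForm (Rogawski1990.qsForm L) w'.1)) := borel _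
  haveI : BorelSpace ↥(unipotentU (galAdicCompletionMap (L := L) (IsCMField.complexConj L) hw') (placeForm (Rogawski1990.qsForm L) w'.1)) := ⟨rfl⟩
  obtain ⟨μN, hμN⟩ := exists_isHaarMeasure_unipotentU (galAdicCompletionMap (L := L) (IsCMField.complexConj L) hw') (placeForm (Rogawski1990.qsForm L) w'.1) hσc'
  have h20 : valuation (w'.1.adicCompletion L) (⅟(2 : (w'.1.adicCompletion L))) ≠ 0 := by
    rw [Valuation.ne_zero_iff]; exact (invertibleInvOf (α := (w'.1.adicCompletion L)) (a := 2)).ne_zero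
  refine tubeJacobianLocal_of_uniformPackage L v hns ν tm Φ hΦ w hw D w' hw' θ hθ0 hθ1 ?_ ?_
  · -- `hDlc`: `D = (Re Δ)²` is locally constant at regular points (★ (J6-D))
    intro t₀ ht₀
    obtain ⟨U, hU, hUo, ht₀U⟩ := eventually_nhds_iff.1 (eventually_vanDijkWeight_eq_of_isRegularElt L v t₀ ht₀)
    exact ⟨U, hUo, ht₀U, fun s hs => NNReal.coe_injective (by rw [hD, hD, hU s hs])⟩
  · -- `hunif`
    intro t₀ ht₀
    have hd₀ := glDiagonal_torusEntry_eq L v t₀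
    obtain ⟨U, hU, hUo, ht₀U⟩ := eventually_nhds_iff.1 (eventually_isRegularElt_and_valued_rootUnits_eq L v t₀ ht₀ hd₀)
    -- the model writing at `t₀`; its four sizes `A B A' B'` are nonzero
    obtain ⟨sw₀, hdw₀, hregw₀, hdsw₀, hregsw₀, h5₀, -⟩ := cm_model_writing L v w' hw' t₀ ht₀ hd₀
    obtain ⟨tw₀, htw₀⟩ : ∃ t : ↥(torusU (galAdicCompletionMap (L := L) (IsCMField.complexConj L) hw') (placeForm (Rogawski1990.qsForm L) w'.1)), (t : ↥(unitaryGroupOfForm (galAdicCompletionMap (L := L) (IsCMField.complexConj L) hw') (placeForm (Rogawski1990.qsForm L) w'.1))) = (localNonsplitEquiv (IsCMField.complexConj L) (Rogawski1990.qsForm L) (IsCMField.complexConj_ne_one L) w' hw') (t₀ : ↥(unitaryGroupOfForm (conjLocal L (IsCMField.complexConj L) v) (cmLocalForm L 3 v))) :=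
      ⟨⟨_, localNonsplitEquiv_coe_mem_torusU L v w' hw' t₀⟩, rfl⟩
    have hdt₀ : glDiagonal 3 (w'.1.adicCompletion L) (fun i => Units.map (Pi.evalRingHom (fun w'' : PlacesOver L v => w''.1.adicCompletion L) w').toMonoidHom (torusEntry (conjLocal L (IsCMField.complexConj L) v) (cmLocalForm L 3 v) i t₀)) = ((tw₀ : ↥(unitaryGroupOfForm (galAdicCompletionMap (L := L) (IsCMField.complexConj L) hw') (placeForm (Rogawski1990.qsForm L) w'.1))) : GL (Fin 3) (w'.1.adicCompletion L)) := by
      rw [htw₀]; exact hdw₀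
    have hregt₀ : IsRegularElt ((tw₀ : ↥(unitaryGroupOfForm (galAdicCompletionMap (L := L) (IsCMField.complexConj L) hw') (placeForm (Rogawski1990.qsForm L) w'.1))) : GL (Fin 3) (w'.1.adicCompletion L)) := by
      rw [htw₀]; exact hregw₀
    obtain ⟨A, hAdef⟩ : ∃ A, A = valuation (w'.1.adicCompletion L) ((((Units.map (Pi.evalRingHom (fun w'' : PlacesOver L v => w''.1.adicCompletion L) w').toMonoidHom (torusEntry (conjLocal L (IsCMField.complexConj L) v) (cmLocalForm L 3 v) 0 t₀))⁻¹ * Units.map (Pi.evalRingHom (fun w'' : PlacesOver L v => w''.1.adicCompletion L) w').toMonoidHom (torusEntry (conjLocal L (IsCMField.complexConj L) v) (cmLocalForm L 3 v) 1 t₀) : ((w'.1.adicCompletion L))ˣ) : (w'.1.adicCompletion L)) - 1) := ⟨_, rfl⟩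
    obtain ⟨B, hBdef⟩ : ∃ B, B = valuation (w'.1.adicCompletion L) ((((Units.map (Pi.evalRingHom (fun w'' : PlacesOver L v => w''.1.adicCompletion L) w').toMonoidHom (torusEntry (conjLocal L (IsCMField.complexConj L) v) (cmLocalForm L 3 v) 0 t₀))⁻¹ * Units.map (Pi.evalRingHom (fun w'' : PlacesOver L v => w''.1.adicCompletion L) w').toMonoidHom (torusEntry (conjLocal L (IsCMField.complexConj L) v) (cmLocalForm L 3 v) 2 t₀) : ((w'.1.adicCompletion L))ˣ) : (w'.1.adicCompletion L)) - 1) := ⟨_, rfl⟩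
    obtain ⟨A', hA'def⟩ : ∃ A', A' = valuation (w'.1.adicCompletion L) ((((Units.map (Pi.evalRingHom (fun w'' : PlacesOver L v => w''.1.adicCompletion L) w').toMonoidHom (torusEntry (conjLocal L (IsCMField.complexConj L) v) (cmLocalForm L 3 v) 2 t₀))⁻¹ * Units.map (Pi.evalRingHom (fun w'' : PlacesOver L v => w''.1.adicCompletion L) w').toMonoidHom (torusEntry (conjLocal L (IsCMField.complexConj L) v) (cmLocalForm L 3 v) 1 t₀) : ((w'.1.adicCompletion L))ˣ) : (w'.1.adicCompletion L)) - 1) := ⟨_, rfl⟩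
    obtain ⟨B', hB'def⟩ : ∃ B', B' = valuation (w'.1.adicCompletion L) ((((Units.map (Pi.evalRingHom (fun w'' : PlacesOver L v => w''.1.adicCompletion L) w').toMonoidHom (torusEntry (conjLocal L (IsCMField.complexConj L) v) (cmLocalForm L 3 v) 2 t₀))⁻¹ * Units.map (Pi.evalRingHom (fun w'' : PlacesOver L v => w''.1.adicCompletion L) w').toMonoidHom (torusEntry (conjLocal L (IsCMField.complexConj L) v) (cmLocalForm L 3 v) 0 t₀) : ((w'.1.adicCompletion L))ˣ) : (w'.1.adicCompletion L)) - 1) := ⟨_, rfl⟩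
    have hA0 : A ≠ 0 := by
      rw [hAdef, Valuation.ne_zero_iff]; exact (isUnit_rootA_sub_one (galAdicCompletionMap (L := L) (IsCMField.complexConj L) hw') tw₀ hdt₀ hregt₀).ne_zero
    have hB0 : B ≠ 0 := by
      rw [hBdef, Valuation.ne_zero_iff]; exact (isUnit_rootB_sub_one (galAdicCompletionMap (L := L) (IsCMField.complexConj L) hw') tw₀ hdt₀ hregt₀).ne_zero
    have hA'0 : A' ≠ 0 := by
      rw [hA'def, Valuation.ne_zero_iff]; exact (isUnit_rootA_sub_one (galAdicCompletionMap (L := L) (IsCMField.complexConj L) hw') sw₀ hdsw₀ hregsw₀).ne_zero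
    have hB'0 : B' ≠ 0 := by
      rw [hB'def, Valuation.ne_zero_iff]; exact (isUnit_rootB_sub_one (galAdicCompletionMap (L := L) (IsCMField.complexConj L) hw') sw₀ hdsw₀ hregsw₀).ne_zero
    obtain ⟨ρ, R, γ₀, -, hρA, hρB, hρA', hρB', hρ1, hRA, hRB, hRA', hRB', hR1, hγ₀0, hsmall⟩ :=
      exists_small_level_bound A B A' B' A A' (valuation (w'.1.adicCompletion L) (⅟(2 : (w'.1.adicCompletion L)))) θ hA0 hB0 hA'0 hB'0 h20 hθ0 hθ1
    refine ⟨U, hUo, ht₀U, γ₀, hγ₀0, fun s hs γ hγ0 hγle => ?_⟩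
    -- at `s ∈ U`: regularity, the model writing, and the sizes agree with those of `t₀`
    have hd := glDiagonal_torusEntry_eq L v s
    obtain ⟨hregs, -, e01, e02, e21, e20⟩ := hU s hs _ hd
    obtain ⟨sw, hdw, hregw, hdsw, hregsw, h5, h6⟩ := cm_model_writing L v w' hw' s hregs hd
    obtain ⟨t, ht⟩ : ∃ t : ↥(torusU (galAdicCompletionMap (L := L) (IsCMField.complexConj L) hw') (placeForm (Rogawski1990.qsForm L) w'.1)), (t : ↥(unitaryGroupOfForm (galAdicCompletionMap (L := L) (IsCMField.complexConj L) hw') (placeForm (Rogawski1990.qsForm L) w'.1))) = (localNonsplitEquiv (IsCMField.complexConj L) (Rogawski1990.qsForm L) (IsCMField.complexConj_ne_one L) w' hw') (s : ↥(unitaryGroupOfForm (conjLocal L (IsCMField.complexConj L) v) (cmLocalForm L 3 v))) :=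
      ⟨⟨_, localNonsplitEquiv_coe_mem_torusU L v w' hw' s⟩, rfl⟩
    have hdt : glDiagonal 3 (w'.1.adicCompletion L) (fun i => Units.map (Pi.evalRingHom (fun w'' : PlacesOver L v => w''.1.adicCompletion L) w').toMonoidHom (torusEntry (conjLocal L (IsCMField.complexConj L) v) (cmLocalForm L 3 v) i s)) = ((t : ↥(unitaryGroupOfForm (galAdicCompletionMap (L := L) (IsCMField.complexConj L) hw') (placeForm (Rogawski1990.qsForm L) w'.1))) : GL (Fin 3) (w'.1.adicCompletion L)) := by
      rw [ht]; exact hdw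
    have hregt : IsRegularElt ((t : ↥(unitaryGroupOfForm (galAdicCompletionMap (L := L) (IsCMField.complexConj L) hw') (placeForm (Rogawski1990.qsForm L) w'.1))) : GL (Fin 3) (w'.1.adicCompletion L)) := by
      rw [ht]; exact hregw
    obtain ⟨hγρ, hRγ, h2R, hRR, hdepth, hdepth', hCA, hCA', hbox, hbox'⟩ := hsmall γ hγ0 hγle
    have hA : valuation (w'.1.adicCompletion L) ((((Units.map (Pi.evalRingHom (fun w'' : PlacesOver L v => w''.1.adicCompletion L) w').toMonoidHom (torusEntry (conjLocal L (IsCMField.complexConj L) v) (cmLocalForm L 3 v) 0 s))⁻¹ * Units.map (Pi.evalRingHom (fun w'' : PlacesOver L v => w''.1.adicCompletion L) w').toMonoidHom (torusEntry (conjLocal L (IsCMField.complexConj L) v) (cmLocalForm L 3 v) 1 s) : ((w'.1.adicCompletion L))ˣ) : (w'.1.adicCompletion L)) - 1) = A := by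
      rw [hAdef]
      exact ((congrArg (valuation (w'.1.adicCompletion L)) (h5 0 1)).trans (valuation_apply_eq_of_valued_eq L v w' (e01 w'))).trans
        (congrArg (valuation (w'.1.adicCompletion L)) (h5₀ 0 1)).symm
    have hB : valuation (w'.1.adicCompletion L) ((((Units.map (Pi.evalRingHom (fun w'' : PlacesOver L v => w''.1.adicCompletion L) w').toMonoidHom (torusEntry (conjLocal L (IsCMField.complexConj L) v) (cmLocalForm L 3 v) 0 s))⁻¹ * Units.map (Pi.evalRingHom (fun w'' : PlacesOver L v => w''.1.adicCompletion L) w').toMonoidHom (torusEntry (conjLocal L (IsCMField.complexConj L) v) (cmLocalForm L 3 v) 2 s) : ((w'.1.adicCompletion L))ˣ) : (w'.1.adicCompletion L)) - 1) = B := by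
      rw [hBdef]
      exact ((congrArg (valuation (w'.1.adicCompletion L)) (h5 0 2)).trans (valuation_apply_eq_of_valued_eq L v w' (e02 w'))).trans
        (congrArg (valuation (w'.1.adicCompletion L)) (h5₀ 0 2)).symm
    have hA' : valuation (w'.1.adicCompletion L) ((((Units.map (Pi.evalRingHom (fun w'' : PlacesOver L v => w''.1.adicCompletion L) w').toMonoidHom (torusEntry (conjLocal L (IsCMField.complexConj L) v) (cmLocalForm L 3 v) 2 s))⁻¹ * Units.map (Pi.evalRingHom (fun w'' : PlacesOver L v => w''.1.adicCompletion L) w').toMonoidHom (torusEntry (conjLocal L (IsCMField.complexConj L) v) (cmLocalForm L 3 v) 1 s) : ((w'.1.adicCompletion L))ˣ) : (w'.1.adicCompletion L)) - 1) = A' := by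
      rw [hA'def]
      exact ((congrArg (valuation (w'.1.adicCompletion L)) (h5 2 1)).trans (valuation_apply_eq_of_valued_eq L v w' (e21 w'))).trans
        (congrArg (valuation (w'.1.adicCompletion L)) (h5₀ 2 1)).symm
    have hB' : valuation (w'.1.adicCompletion L) ((((Units.map (Pi.evalRingHom (fun w'' : PlacesOver L v => w''.1.adicCompletion L) w').toMonoidHom (torusEntry (conjLocal L (IsCMField.complexConj L) v) (cmLocalForm L 3 v) 2 s))⁻¹ * Units.map (Pi.evalRingHom (fun w'' : PlacesOver L v => w''.1.adicCompletion L) w').toMonoidHom (torusEntry (conjLocal L (IsCMField.complexConj L) v) (cmLocalForm L 3 v) 0 s) : ((w'.1.adicCompletion L))ˣ) : (w'.1.adicCompletion L)) - 1) = B' := by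
      rw [hB'def]
      exact ((congrArg (valuation (w'.1.adicCompletion L)) (h5 2 0)).trans (valuation_apply_eq_of_valued_eq L v w' (e20 w'))).trans
        (congrArg (valuation (w'.1.adicCompletion L)) (h5₀ 2 0)).symm
    -- the model package at `(t = e s, sw)` for the level `γ` (★ (J6-M))
    obtain ⟨P, -, hOrb, hmass⟩ := orbit_and_mass_of_small_level (galAdicCompletionMap (L := L) (IsCMField.complexConj L) hw') hσσ hσc' hJ' hσv μN
      t sw hdt hdsw hregt hregsw
      hA hB hA' hB' ((h6 0 1).trans_eq hA) ((h6 2 1).trans_eq hA') hρA hρB hρA' hρB' hρ1 hRA hRB hRA' hRB' hR1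
      hγ0 hγρ hRγ h2R hRR hdepth hdepth' hCA hCA' hbox hbox'
    rw [ht] at hOrb
    refine ⟨P, hOrb, fun ν' hν' => ?_⟩
    rw [hmass ν' hν']
    congr 1
    rw [← ENNReal.coe_mul, ENNReal.coe_inj]
    apply NNReal.coe_injective
    rw [NNReal.coe_mul, hD]
    exact hT4 s hregs _ hd t sw ht (fun i => Units.map (Pi.evalRingHom (fun w'' : PlacesOver L v => w''.1.adicCompletion L) w').toMonoidHom (torusEntry (conjLocal L (IsCMField.complexConj L) v) (cmLocalForm L 3 v) i s)) h5 hdt hdsw hregt hregsw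

end CM

end Summit.HodgeConjecture.HodgeConjecture.Cruxes.H413.F0P3cStCharTSWeylHypJacobianClose

end
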